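import Mathlib
import Summits.NavierStokesRegularity.FluidComputer.TransportGalerkinLevelGenerators
import HarnessLib

/-!
# The transport Galerkin model: KEEP and KILL with the level generators discharged (instab g17, cell `ns-blowup`, 2026-08-27)

HONEST FRAMING (human ruling D-0035): nothing here is a claim about Navier–Stokes blow-up.
WHAT THIS IS NOT: not NS evidence — `TransportGalerkinEmergence.half_prediction_nsField` /
`decay_two_nsField` with the hypothesis «bounded level generators `A_n`» REMOVED
(`TransportGalerkinLevelGenerators.exists_levelGenerators`): the eigen-consistency is stated on
`P_n (linOp (P_n v))` directly (`A_n (P_n v) = P_n (linOp (P_n v))` by idempotence). Remaining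
hypotheses: host + box data, RESIDENCE (β3), the block weights and THE CERTIFICATE
(`HOME/instab/BETA2-SPEC.md` §7), the (B) law for `bilOp`, the eigen / seed data.
Mathlib + the tree files cited; no new definitions.
-/

noncomputable section

namespace Summit.NavierStokesRegularity.FluidComputer.TransportGalerkinKeepKill

open Set Filter Topology Finset RCLike
open Literature.Analysis.FunctionSpaces Literature.Analysis.FunctionSpaces.Lattice
open Literature.Analysis.FunctionSpaces.Torus Literature.Analysis.ODE
open Summit.NavierStokesRegularity.FluidComputer.TransportGalerkin
open Summit.NavierStokesRegularity.FluidComputer.TransportGalerkinEmergence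
open Summit.NavierStokesRegularity.FluidComputer.TransportGalerkinLevelGenerators
open scoped ENNReal NNReal ComplexConjugate InnerProductSpace

variable {d : Type*} [Fintype d] [DecidableEq d]
variable {V : Type*} [NormedAddCommGroup V] [InnerProductSpace ℂ V] [CompleteSpace V] [ProperSpace V]
variable {ρ : (d → ℤ) → ℝ} {ν : ℝ} {Uv : (d → ℤ) → V} {π : d → (V →L[ℂ] ℂ)} {P : (d → ℤ) → (V →L[ℂ] V)}

/-- **KEEP for the transport model with the level generators discharged** (eigen-consistency on
`P_n (linOp (P_n v))`). -/
theorem half_prediction_nsField' (hν : 0 ≤ ν) (hUv : RapidDecay Uv)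
    (hUreal : ∀ j p, π j (Uv (-p)) = conj (π j (Uv p)))
    (hUdiv : ∑ j, freqDeriv j (fun p => π j (Uv p)) = 0) (hπ : ∀ j, ‖π j‖ ≤ 1)
    (hPsa : ∀ k, IsSelfAdjoint (P k)) (hPn : ∀ k, ‖P k‖ ≤ 1)
    (hρ0 : ∀ k, 0 ≤ ρ k) (hρ1 : Summable fun k => sobolevWeight 1 k * ρ k)
    (hρ2 : Summable fun k => (sobolevWeight 2 k * ρ k) ^ 2)
    {Z : Set (lp (fun _ : (d → ℤ) => V) 2)} {T : ℝ}
    {u : ℕ → lp (fun _ : (d → ℤ) => V) 2 → ℝ → lp (fun _ : (d → ℤ) => V) 2}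
    (hT : 0 ≤ T) (hZ : Z ⊆ box ρ π P)
    (sol_continuousOn : ∀ n, ∀ x ∈ Z, ContinuousOn (u n x) (Icc 0 T))
    (sol_init : ∀ n, ∀ x ∈ Z, u n x 0 = cubeProj n x)
    (sol_hasDerivAt : ∀ n, ∀ x ∈ Z, ∀ t ∈ Ioo 0 T,
      HasDerivAt (u n x) (cubeProj n (nsField ν Uv π P (u n x t))) t)
    (sol_mem : ∀ n, ∀ x ∈ Z, ∀ t ∈ Icc 0 T, u n x t ∈ box ρ π P)
    (sol_proj : ∀ n, ∀ x ∈ Z, ∀ t ∈ Icc 0 T, cubeProj n (u n x t) = u n x t)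
    {μ : ℝ}
    {G₁ G₂ D₁ G : lp (fun _ : (d → ℤ) => V) 2 →L[ℝ] lp (fun _ : (d → ℤ) => V) 2}
    (hG₁ : ∀ x y : lp (fun _ : (d → ℤ) => V) 2, ⟪G₁ x, y⟫_ℂ = ⟪x, G₁ y⟫_ℂ)
    (hG₂ : ∀ x y : lp (fun _ : (d → ℤ) => V) 2, ⟪G₂ x, y⟫_ℂ = ⟪x, G₂ y⟫_ℂ)
    (hG : ∀ x y : lp (fun _ : (d → ℤ) => V) 2, ⟪G x, y⟫_ℂ = ⟪x, G y⟫_ℂ)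
    (hG₁P : ∀ n, ∀ w z : lp (fun _ : (d → ℤ) => V) 2, ⟪G₁ w, cubeProj n z⟫_ℂ = ⟪G₁ (cubeProj n w), z⟫_ℂ)
    (hG₂P : ∀ n, ∀ w z : lp (fun _ : (d → ℤ) => V) 2, ⟪G₂ w, cubeProj n z⟫_ℂ = ⟪G₂ (cubeProj n w), z⟫_ℂ)
    (hD₁P : ∀ n, ∀ w z : lp (fun _ : (d → ℤ) => V) 2, ⟪D₁ w, cubeProj n z⟫_ℂ = ⟪D₁ (cubeProj n w), z⟫_ℂ)
    (hGP : ∀ n, ∀ w z : lp (fun _ : (d → ℤ) => V) 2, ⟪G w, cubeProj n z⟫_ℂ = ⟪G (cubeProj n w), z⟫_ℂ)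
    (hG₁pos : ∀ x : lp (fun _ : (d → ℤ) => V) 2, 0 ≤ re ⟪G₁ x, x⟫_ℂ) {ω c m₂ M₁ : ℝ} (hc : 0 < c)
    (hm₂ : 0 < m₂) (hM₁ : 0 ≤ M₁)
    (hm₂' : ∀ x : lp (fun _ : (d → ℤ) => V) 2, m₂ * ‖x‖ ^ 2 ≤ re ⟪G₂ x, x⟫_ℂ)
    (hD₁ : ∀ x : lp (fun _ : (d → ℤ) => V) 2, 0 ≤ re ⟪D₁ x, x⟫_ℂ)
    (hM₁' : ∀ x : lp (fun _ : (d → ℤ) => V) 2, re ⟪G₁ x, x⟫_ℂ ≤ M₁ * re ⟪D₁ x, x⟫_ℂ)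
    {m M ω₁ : ℝ} (hm0 : 0 < m) (hm : ∀ x : lp (fun _ : (d → ℤ) => V) 2, m * ‖x‖ ^ 2 ≤ re ⟪G x, x⟫_ℂ)
    (hM : ∀ x : lp (fun _ : (d → ℤ) => V) 2, re ⟪G x, x⟫_ℂ ≤ M * ‖x‖ ^ 2)
    (h₁ : ∀ n, ∀ w : lp (fun _ : (d → ℤ) => V) 2,
      2 * re ⟪G₁ (cubeProj n w), linOp ν Uv π P (cubeProj n w)⟫_ℂ + c * re ⟪G₂ (cubeProj n w), cubeProj n w⟫_ℂ ≤
        2 * ω * re ⟪G₁ (cubeProj n w), cubeProj n w⟫_ℂ)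
    (h₂ : ∀ n, ∀ w : lp (fun _ : (d → ℤ) => V) 2,
      re ⟪G₂ (cubeProj n w), linOp ν Uv π P (cubeProj n w)⟫_ℂ ≤ ω * re ⟪G₂ (cubeProj n w), cubeProj n w⟫_ℂ)
    (hL : ∀ n, ∀ w : lp (fun _ : (d → ℤ) => V) 2,
      re ⟪G (cubeProj n w), linOp ν Uv π P (cubeProj n w)⟫_ℂ ≤ ω₁ * re ⟪G (cubeProj n w), cubeProj n w⟫_ℂ)
    (hμ₁ : μ ≤ ω₁) (hμ₂ : μ ≤ ω)
    (htail : ∀ n, ∀ q : lp (fun _ : (d → ℤ) => V) 2, cubeProj n q = 0 →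
      2 * μ * re ⟪G₁ q, q⟫_ℂ + c * re ⟪G₂ q, q⟫_ℂ ≤ 2 * ω * re ⟪G₁ q, q⟫_ℂ)
    {calg : ℝ} (hcalg : 0 ≤ calg)
    (hB : ∀ x y : lp (fun _ : (d → ℤ) => V) 2,
      Real.sqrt (re ⟪D₁ (bilOp π P x y), bilOp π P x y⟫_ℂ) ≤ calg * ‖x‖ * ‖y‖)
    {v : lp (fun _ : (d → ℤ) => V) 2} (hv1 : ‖v‖ = 1) {lam ε : ℝ} (hgap : ω < 2 * lam)
    (hlam : 0 ≤ lam) (hε : 0 < ε) (hx : ε • v ∈ Z)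
    (hres : Tendsto (fun n => ‖cubeProj n (linOp ν Uv π P (cubeProj n v)) - lam • cubeProj n v‖)
      atTop (𝓝 0))
    {C' : ℝ}
    (hCC' : Real.sqrt (M₁ / (c * m₂)) * calg * Real.sqrt (Real.pi / (2 * lam - ω)) < C')
    (hsmall : ∀ t ∈ Icc 0 T, C' * (3 / 2 : ℝ) ^ 2 * (ε * Real.exp (lam * t)) < 3 / 2 - 1)
    {w : ℝ → lp (fun _ : (d → ℤ) => V) 2} (hw : ContinuousOn w (Icc 0 T)) (hw0 : w 0 = ε • v)
    (hw' : ∀ t ∈ Ioo 0 T, HasDerivAt w (nsField ν Uv π P (w t)) t) (hwW : ∀ t ∈ Icc 0 T, w t ∈ box ρ π P)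
    {t : ℝ} (ht : t ∈ Icc 0 T) (hχ : ε * Real.exp (lam * t) ≤ 2 / (9 * C')) :
    ε * Real.exp (lam * t) / 2 ≤ ‖w t‖ := by
  obtain ⟨An, hAn⟩ := exists_levelGenerators (ν := ν) (P := P) hUv hπ hPn μ
  have hfix : ∀ n, An n (cubeProj n v) = cubeProj n (linOp ν Uv π P (cubeProj n v)) := fun n => by
    rw [hAn, lpProj_idem, sub_self, smul_zero, add_zero]
  exact half_prediction_nsField hν hUv hUreal hUdiv hπ hPsa hPn hρ0 hρ1 hρ2 hT hZ sol_continuousOn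
    sol_init sol_hasDerivAt sol_mem sol_proj An hAn hG₁ hG₂ hG hG₁P hG₂P hD₁P hGP hG₁pos hc hm₂ hM₁
    hm₂' hD₁ hM₁' hm0 hm hM h₁ h₂ hL hμ₁ hμ₂ htail hcalg hB hv1 hgap hlam hε hx
    (hres.congr fun n => by rw [hfix]) hCC' hsmall hw hw0 hw' hwW ht hχ

/-- **KILL for the transport model with the level generators discharged.** -/
theorem decay_two_nsField' (hν : 0 ≤ ν) (hUv : RapidDecay Uv)
    (hUreal : ∀ j p, π j (Uv (-p)) = conj (π j (Uv p)))
    (hUdiv : ∑ j, freqDeriv j (fun p => π j (Uv p)) = 0) (hπ : ∀ j, ‖π j‖ ≤ 1)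
    (hPsa : ∀ k, IsSelfAdjoint (P k)) (hPn : ∀ k, ‖P k‖ ≤ 1)
    (hρ0 : ∀ k, 0 ≤ ρ k) (hρ1 : Summable fun k => sobolevWeight 1 k * ρ k)
    (hρ2 : Summable fun k => (sobolevWeight 2 k * ρ k) ^ 2)
    {Z : Set (lp (fun _ : (d → ℤ) => V) 2)} {T : ℝ}
    {u : ℕ → lp (fun _ : (d → ℤ) => V) 2 → ℝ → lp (fun _ : (d → ℤ) => V) 2}
    (hT : 0 ≤ T) (hZ : Z ⊆ box ρ π P)
    (sol_continuousOn : ∀ n, ∀ x ∈ Z, ContinuousOn (u n x) (Icc 0 T))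
    (sol_init : ∀ n, ∀ x ∈ Z, u n x 0 = cubeProj n x)
    (sol_hasDerivAt : ∀ n, ∀ x ∈ Z, ∀ t ∈ Ioo 0 T,
      HasDerivAt (u n x) (cubeProj n (nsField ν Uv π P (u n x t))) t)
    (sol_mem : ∀ n, ∀ x ∈ Z, ∀ t ∈ Icc 0 T, u n x t ∈ box ρ π P)
    (sol_proj : ∀ n, ∀ x ∈ Z, ∀ t ∈ Icc 0 T, cubeProj n (u n x t) = u n x t)
    {μ : ℝ}
    {G₁ G₂ D₁ G : lp (fun _ : (d → ℤ) => V) 2 →L[ℝ] lp (fun _ : (d → ℤ) => V) 2}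
    (hG₁ : ∀ x y : lp (fun _ : (d → ℤ) => V) 2, ⟪G₁ x, y⟫_ℂ = ⟪x, G₁ y⟫_ℂ)
    (hG₂ : ∀ x y : lp (fun _ : (d → ℤ) => V) 2, ⟪G₂ x, y⟫_ℂ = ⟪x, G₂ y⟫_ℂ)
    (hG : ∀ x y : lp (fun _ : (d → ℤ) => V) 2, ⟪G x, y⟫_ℂ = ⟪x, G y⟫_ℂ)
    (hG₁P : ∀ n, ∀ w z : lp (fun _ : (d → ℤ) => V) 2, ⟪G₁ w, cubeProj n z⟫_ℂ = ⟪G₁ (cubeProj n w), z⟫_ℂ)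
    (hG₂P : ∀ n, ∀ w z : lp (fun _ : (d → ℤ) => V) 2, ⟪G₂ w, cubeProj n z⟫_ℂ = ⟪G₂ (cubeProj n w), z⟫_ℂ)
    (hD₁P : ∀ n, ∀ w z : lp (fun _ : (d → ℤ) => V) 2, ⟪D₁ w, cubeProj n z⟫_ℂ = ⟪D₁ (cubeProj n w), z⟫_ℂ)
    (hGP : ∀ n, ∀ w z : lp (fun _ : (d → ℤ) => V) 2, ⟪G w, cubeProj n z⟫_ℂ = ⟪G (cubeProj n w), z⟫_ℂ)
    (hG₁pos : ∀ x : lp (fun _ : (d → ℤ) => V) 2, 0 ≤ re ⟪G₁ x, x⟫_ℂ) {ω c m₂ M₁ : ℝ} (hc : 0 < c)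
    (hm₂ : 0 < m₂) (hM₁ : 0 ≤ M₁)
    (hm₂' : ∀ x : lp (fun _ : (d → ℤ) => V) 2, m₂ * ‖x‖ ^ 2 ≤ re ⟪G₂ x, x⟫_ℂ)
    (hD₁ : ∀ x : lp (fun _ : (d → ℤ) => V) 2, 0 ≤ re ⟪D₁ x, x⟫_ℂ)
    (hM₁' : ∀ x : lp (fun _ : (d → ℤ) => V) 2, re ⟪G₁ x, x⟫_ℂ ≤ M₁ * re ⟪D₁ x, x⟫_ℂ)
    {m M ω₁ : ℝ} (hm0 : 0 < m) (hm : ∀ x : lp (fun _ : (d → ℤ) => V) 2, m * ‖x‖ ^ 2 ≤ re ⟪G x, x⟫_ℂ)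
    (hM : ∀ x : lp (fun _ : (d → ℤ) => V) 2, re ⟪G x, x⟫_ℂ ≤ M * ‖x‖ ^ 2)
    (h₁ : ∀ n, ∀ w : lp (fun _ : (d → ℤ) => V) 2,
      2 * re ⟪G₁ (cubeProj n w), linOp ν Uv π P (cubeProj n w)⟫_ℂ + c * re ⟪G₂ (cubeProj n w), cubeProj n w⟫_ℂ ≤
        2 * ω * re ⟪G₁ (cubeProj n w), cubeProj n w⟫_ℂ)
    (h₂ : ∀ n, ∀ w : lp (fun _ : (d → ℤ) => V) 2,
      re ⟪G₂ (cubeProj n w), linOp ν Uv π P (cubeProj n w)⟫_ℂ ≤ ω * re ⟪G₂ (cubeProj n w), cubeProj n w⟫_ℂ)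
    (hL : ∀ n, ∀ w : lp (fun _ : (d → ℤ) => V) 2,
      re ⟪G (cubeProj n w), linOp ν Uv π P (cubeProj n w)⟫_ℂ ≤ ω₁ * re ⟪G (cubeProj n w), cubeProj n w⟫_ℂ)
    (hμ₁ : μ ≤ ω₁) (hμ₂ : μ ≤ ω)
    (htail : ∀ n, ∀ q : lp (fun _ : (d → ℤ) => V) 2, cubeProj n q = 0 →
      2 * μ * re ⟪G₁ q, q⟫_ℂ + c * re ⟪G₂ q, q⟫_ℂ ≤ 2 * ω * re ⟪G₁ q, q⟫_ℂ)
    {lam : ℝ} (hgap : ω < 2 * lam) (hlam : lam ≤ 0) (hrate : ω₁ ≤ lam)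
    {calg : ℝ} (hcalg : 0 ≤ calg)
    (hB : ∀ x y : lp (fun _ : (d → ℤ) => V) 2,
      Real.sqrt (re ⟪D₁ (bilOp π P x y), bilOp π P x y⟫_ℂ) ≤ calg * ‖x‖ * ‖y‖)
    {x : lp (fun _ : (d → ℤ) => V) 2} (hxZ : x ∈ Z) {ε : ℝ} (hε : 0 < ε)
    (hseed : Real.sqrt (M / m) * ‖x‖ < ε)
    (hbasin : 4 * (Real.sqrt (M₁ / (c * m₂)) * calg * Real.sqrt (Real.pi / (2 * lam - ω))) * ε < 1)
    {w : ℝ → lp (fun _ : (d → ℤ) => V) 2} (hw : ContinuousOn w (Icc 0 T)) (hw0 : w 0 = x)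
    (hw' : ∀ t ∈ Ioo 0 T, HasDerivAt w (nsField ν Uv π P (w t)) t)
    (hwW : ∀ t ∈ Icc 0 T, w t ∈ box ρ π P) :
    ∀ t ∈ Icc 0 T, ‖w t‖ ≤ 2 * (ε * Real.exp (lam * t)) := by
  obtain ⟨An, hAn⟩ := exists_levelGenerators (ν := ν) (P := P) hUv hπ hPn μ
  exact decay_two_nsField hν hUv hUreal hUdiv hπ hPsa hPn hρ0 hρ1 hρ2 hT hZ sol_continuousOn
    sol_init sol_hasDerivAt sol_mem sol_proj An hAn hG₁ hG₂ hG hG₁P hG₂P hD₁P hGP hG₁pos hc hm₂ hM₁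
    hm₂' hD₁ hM₁' hm0 hm hM h₁ h₂ hL hμ₁ hμ₂ htail hgap hlam hrate hcalg hB hxZ hε hseed hbasin hw
    hw0 hw' hwW

end Summit.NavierStokesRegularity.FluidComputer.TransportGalerkinKeepKill

end
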